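import Mathlib
import Summits.HodgeConjecture.HodgeConjecture.Theorems.PadicSemiregularLiftHodgeAbelianVarietiesAndrePowerHOne
import Literature.AlgebraicGeometry.Motives.AbelianVarietyCohomologyExteriorH1

/-!
# Crux `HodgeAbelianVarieties` (stmt-HodgeConjecture-1333), line `cm-pivot-andre` — André with CM targets, module L3e: the key identity `ι₀^* ((π^* x)_D) = n • x`

Setting of the lead's André construction (`work/andre/PLAN.md` §6): `B = A ⊗ O_E ≅ Aⁿ`, `ι₀ : A → B` the first
injection, `π = Σ p_i π_i : B → A`, `Y = θ ∈ End B` diagonal on the line basis `𝔅(λ,s)` of `H¹(B)` with eigenvalues the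
conjugates `ρ_s` (all distinct), `ι₀^* 𝔅(λ,s) = v_λ`, `π^* v_λ = Σ_s 𝔅(λ,s)`; `Bw` the wedge basis of `Hᵈ(B)` and
`R_k` the rational symmetric-function operators, whose joint kernel is spanned by the "single-embedding" monomials
`Bw S` (`S ⊆ Fin N × {s}`). The `D`-component of a class `y ∈ Hᵈ(B)` is its part on those monomials, and the KEY IDENTITY
is `ι₀^* ((π^* x)_D) = n • x` for all `x ∈ Hᵈ(A)`: on `x = v_{τ₁} ⌣ ⋯ ⌣ v_{τ_d}`,
`π^* x = Σ_σ 𝔅(τ₁,σ₁) ⌣ ⋯ ⌣ 𝔅(τ_d,σ_d)`; a non-constant `σ` gives an eigenvector on which some `R_k` is invertible,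
hence with zero `D`-component; a constant `σ ≡ s` gives an element of the joint kernel, fixed by the projection, and
`ι₀^*` of it is `x` again — `n` times. All inputs are hypotheses (outputs of modules L2a, L3a, L3b, L3c).
-/

set_option linter.dupNamespace false

noncomputable section

namespace Summit.HodgeConjecture.HodgeConjecture.Theorems.HodgeAbelianVarieties.CMPivotAndre

open CategoryTheory
open Literature.AlgebraicTopology.SingularHomology
open Literature.AlgebraicGeometry Literature.AlgebraicGeometry.Motives Literature.AlgebraicGeometry.HodgeTheory

/-- **The key identity `ι₀^* ((π^* x)_D) = n • x`.** In the setting of the module docstring (all structure passed as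
hypotheses: the `Y`-eigenbasis `𝔅` of `H¹(B)` with `ι₀^* 𝔅(λ,s) = v_λ` and `π^* v_λ = Σ_s 𝔅(λ,s)`, the wedge basis
`Bw` with its product formula, operators `R_k` with the symmetric-function eigenvalues on joint eigenvectors of the
`(x•𝟙 + Y)^*`, and the constant-multiset criterion), for every `x ∈ Hᵈ(A(ℂ); ℂ)` the pull-back along `ι₀` of the
single-embedding component of `π^* x` equals `n • x`. [cite: Andre1992HodgeCM, Théorème]
[cite: Deligne1982HodgeCycles, §4 (4.3)–(4.4)] -/
theorem andre_keyIdentity : ∀ {N n d : ℕ} (A B : Literature.AlgebraicGeometry.Motives.AbelianVariety ℂ) (ι₀ : A ⟶ B) (πp : B ⟶ A) (Y : B ⟶ B) (v : Module.Basis (Fin N) ℂ (Literature.AlgebraicGeometry.HodgeTheory.complexBetti A.X 1)) (𝔅 : Module.Basis (Fin N × Fin n) ℂ (Literature.AlgebraicGeometry.HodgeTheory.complexBetti B.X 1)) (ρ : Fin n → ℂ) (Bw : Module.Basis (Set.powersetCard (Fin N × Fin n) d) ℂ (Literature.AlgebraicGeometry.HodgeTheory.complexBetti B.X d)) (R : ℕ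 → (Literature.AlgebraicGeometry.HodgeTheory.complexBetti B.X d →ₗ[ℂ] Literature.AlgebraicGeometry.HodgeTheory.complexBetti B.X d)), 0 < d → Function.Injective ρ → (∀ l s, Literature.AlgebraicGeometry.HodgeTheory.complexBetti.map Y.hom.hom.hom 1 (𝔅 (l, s)) = ρ s • 𝔅 (l, s)) → (∀ l s, Literature.AlgebraicGeometry.HodgeTheory.complexBetti.map ι₀.hom.hom.hom 1 (𝔅 (l, s)) = v l) → (∀ l, Literature.AlgebraicGeometry.HodgeTheory.complexBetti.map πp.hom.hom.hom 1 (v l) = ∑ s, 𝔅 (l, s)) → (∀ (f : B ⟶ B) (a : Fin N × Fin n → ℂ), (∀ i, Literature.AlgebraicGeometry.HodgeTheory.complexBetti.map f.hom.hom.hom 1 (𝔅 i) = a i • 𝔅 i) → ∀ S, Literature.AlgebraicGeometry.HodgeTheory.complexBetti.map f.hom.hom.hom d (Bw S) = (∏ i ∈ (S : Finset (Fin N × Fin n)), a i) • Bw S) → (∀ k, k ≤ d → ∀ (t : Literature.AlgebraicGeometry.HodgeTheory.complexBetti B.X d) (M : Multiset ℂ), M.card = d → (∀ x : ℕ, Literature.AlgebraicGeometry.HodgeTheory.complexBetti.map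 (x • 𝟙 B + Y).hom.hom.hom d t = (M.map fun r => (x : ℂ) + r).prod • t) → R k t = ((d : ℂ) ^ k * M.esymm k - (d.choose k : ℂ) * M.esymm 1 ^ k) • t) → (∀ M : Multiset ℂ, M.card = d → ((∀ k : ℕ, k ≤ d → (d : ℂ) ^ k * M.esymm k = (d.choose k : ℂ) * M.esymm 1 ^ k) ↔ ∃ r : ℂ, M = Multiset.replicate d r)) → ∀ x : Literature.AlgebraicGeometry.HodgeTheory.complexBetti A.X d, Literature.AlgebraicGeometry.HodgeTheory.complexBetti.map ι₀.hom.hom.hom d (∑ S ∈ Finset.univ.filter (fun S : Set.powersetCard (Fin N × Fin n) d => ∀ k : Fin (d + 1), (d : ℂ) ^ (k : ℕ) * (((S : Finset (Fin N × Fin n)).val.map fun i => ρ i.2).esymm k) - (d.choose k : ℂ) * (((S : Finset (Fin N × Fin n)).val.map fun i => ρ i.2).esymm 1) ^ (k : ℕ) = 0), Bw.repr (Literature.AlgebraicGeometry.HodgeTheory.complexBetti.map πp.hom.hom.hom d x) S • Bw S) = (n : ℂ) • x := by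
  intro N n d A B ι₀ πp Y v 𝔅 ρ Bw R hd hρ hY hι hπ hBw hR hcrit
  classical
  -- abbreviations
  let rval : ℕ → Multiset ℂ → ℂ := fun k M => (d : ℂ) ^ k * M.esymm k - (d.choose k : ℂ) * M.esymm 1 ^ k
  let MS : Set.powersetCard (Fin N × Fin n) d → Multiset ℂ := fun S =>
    ((S : Finset (Fin N × Fin n)).val.map fun i => ρ i.2)
  let Dp : Set.powersetCard (Fin N × Fin n) d → Prop := fun S => ∀ k : Fin (d + 1), rval k (MS S) = 0
  let F : Finset (Set.powersetCard (Fin N × Fin n) d) := Finset.univ.filter fun S => Dp S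
  -- the `D`-projection as a linear map
  let maskD : complexBetti B.X d →ₗ[ℂ] complexBetti B.X d := ∑ S ∈ F, (Bw.coord S).smulRight (Bw S)
  have hmaskD_apply : ∀ y, maskD y = ∑ S ∈ F, Bw.repr y S • Bw S := by
    intro y
    simp only [maskD, LinearMap.coe_sum, Finset.sum_apply, LinearMap.smulRight_apply, Module.Basis.coord_apply]
  -- the statement as an identity of linear maps, to be checked on cup monomials
  suffices key : ∀ x : complexBetti A.X d,
      complexBetti.map ι₀.hom.hom.hom d (maskD (complexBetti.map πp.hom.hom.hom d x)) = (n : ℂ) • x by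
    intro x
    have := key x
    rw [hmaskD_apply] at this
    exact this
  -- multisets of conjugates and the eigenvalue pattern on `Bw`
  have hMScard : ∀ S, (MS S).card = d := fun S => by
    simp only [MS, Multiset.card_map, Finset.card_val, Set.powersetCard.card_eq]
  have hGY : ∀ (x : ℕ) (i : Fin N × Fin n),
      complexBetti.map ((x • 𝟙 B + Y) : B ⟶ B).hom.hom.hom 1 (𝔅 i) = ((x : ℂ) + ρ i.2) • 𝔅 i := by
    rintro x ⟨l, s⟩
    rw [complexBetti_map_add_one]
    change (complexBetti.map (x • 𝟙 B : B ⟶ B).hom.hom.hom 1 + complexBetti.map Y.hom.hom.hom 1).hom (𝔅 (l, s)) = _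
    rw [ModuleCat.hom_add, LinearMap.add_apply, complexBetti_map_nsmul_one]
    change (x • complexBetti.map (𝟙 B : B ⟶ B).hom.hom.hom 1).hom (𝔅 (l, s)) + complexBetti.map Y.hom.hom.hom 1 (𝔅 (l, s)) = _
    rw [ModuleCat.hom_nsmul, LinearMap.smul_apply, hY]
    change x • complexBetti.map (𝟙 B : B ⟶ B).hom.hom.hom 1 (𝔅 (l, s)) + _ = _
    rw [complexBetti_map_id_one_apply, add_smul, Nat.cast_smul_eq_nsmul]
  have hGBw : ∀ (x : ℕ) S, complexBetti.map ((x • 𝟙 B + Y) : B ⟶ B).hom.hom.hom d (Bw S) =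
      ((MS S).map fun r => (x : ℂ) + r).prod • Bw S := by
    intro x S
    rw [hBw _ _ (hGY x) S]
    simp only [MS, Multiset.map_map, Finset.prod_eq_multiset_prod, Function.comp_def]
  have hRBw : ∀ k, k ≤ d → ∀ S, R k (Bw S) = rval k (MS S) • Bw S := fun k hk S =>
    hR k hk (Bw S) (MS S) (hMScard S) (fun x => hGBw x S)
  have hRrepr : ∀ k, k ≤ d → ∀ (t : complexBetti B.X d) S, Bw.repr (R k t) S = rval k (MS S) * Bw.repr t S := by
    intro k hk t S
    have hRt : R k t = ∑ S', (Bw.repr t S' * rval k (MS S')) • Bw S' := by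
      conv_lhs => rw [← Bw.sum_repr t]
      rw [map_sum]
      refine Finset.sum_congr rfl fun S' _ => ?_
      rw [map_smul, hRBw k hk, smul_smul]
    rw [hRt, Bw.repr_sum_self, mul_comm]
  -- CLAIM A: an `R_k`-eigenvector with non-zero eigenvalue has zero `D`-component
  have claimA : ∀ (t : complexBetti B.X d) k (r : ℂ), k ≤ d → r ≠ 0 → R k t = r • t → maskD t = 0 := by
    intro t k r hk hr ht
    rw [hmaskD_apply]
    refine Finset.sum_eq_zero fun S hS => ?_
    have hS' : Dp S := (Finset.mem_filter.mp hS).2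
    have h1 := hRrepr k hk t S
    rw [ht, map_smul, Finsupp.smul_apply, smul_eq_mul, hS' ⟨k, Nat.lt_succ_of_le hk⟩, zero_mul] at h1
    rw [(mul_eq_zero.mp h1).resolve_left hr, zero_smul]
  -- CLAIM B: a vector killed by all `R_k` (`k ≤ d`) is its own `D`-component
  have claimB : ∀ (t : complexBetti B.X d), (∀ k, k ≤ d → R k t = 0) → maskD t = t := by
    intro t ht
    rw [hmaskD_apply]
    conv_rhs => rw [← Bw.sum_repr t, ← Finset.sum_filter_add_sum_filter_not Finset.univ (fun S => Dp S)]
    rw [left_eq_add]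
    refine Finset.sum_eq_zero fun S hS => ?_
    have hS' : ¬ Dp S := (Finset.mem_filter.mp hS).2
    simp only [Dp, not_forall] at hS'
    obtain ⟨k, hk⟩ := hS'
    have h1 := hRrepr k (Nat.le_of_lt_succ k.2) t S
    rw [ht k (Nat.le_of_lt_succ k.2), map_zero, Finsupp.zero_apply] at h1
    rw [(mul_eq_zero.mp h1.symm).resolve_left hk, zero_smul]
  -- cup monomials and their behaviour
  have hΛA : HasExteriorCohomologyH1 ℂ (ComplexPoints A.X) := AbelianVariety.hasExteriorCohomologyH1_complexPoints A
  let cupB : (Fin d → complexBetti B.X 1) → complexBetti B.X d := fun w => cupPowOne ℂ (ComplexPoints B.X) d w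
  let cupA : (Fin d → complexBetti A.X 1) → complexBetti A.X d := fun w => cupPowOne ℂ (ComplexPoints A.X) d w
  -- the terms `t σ = 𝔅(τ 0, σ 0) ⌣ ⋯` for `x = v (τ 0) ⌣ ⋯`
  have main : ∀ τ : Fin d → Fin N,
      complexBetti.map ι₀.hom.hom.hom d (maskD (complexBetti.map πp.hom.hom.hom d (cupA (v ∘ τ)))) =
        (n : ℂ) • cupA (v ∘ τ) := by
    intro τ
    set t : (Fin d → Fin n) → complexBetti B.X d := fun σ => cupB fun j => 𝔅 (τ j, σ j) with ht
    -- `π^* x = Σ_σ t σ`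
    have hpull : complexBetti.map πp.hom.hom.hom d (cupA (v ∘ τ)) = ∑ σ : Fin d → Fin n, t σ := by
      change singularCohomology.map ℂ ℂ (AlgPoints.mapContinuous (L := ℂ) πp.hom.hom.hom) d
        (cupPowOne ℂ _ d (v ∘ τ)) = _
      rw [map_cupPowOne]
      have e : (fun j => singularCohomology.map ℂ ℂ (AlgPoints.mapContinuous (L := ℂ) πp.hom.hom.hom) 1 ((v ∘ τ) j)) =
          fun j => ∑ s ∈ (Finset.univ : Finset (Fin n)), 𝔅 (τ j, s) := by
        funext j
        exact hπ (τ j)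
      rw [e, MultilinearMap.map_sum_finset, Fintype.piFinset_univ]
    -- each `t σ` is a joint eigenvector of the `(x•𝟙 + Y)^*` with multiset `M σ`
    have heig : ∀ σ (x : ℕ), complexBetti.map ((x • 𝟙 B + Y) : B ⟶ B).hom.hom.hom d (t σ) =
        ((Finset.univ.val.map fun j => ρ (σ j)).map fun r => (x : ℂ) + r).prod • t σ := by
      intro σ x
      change singularCohomology.map ℂ ℂ (AlgPoints.mapContinuous (L := ℂ) _) d (cupPowOne ℂ _ d _) = _
      rw [map_cupPowOne]
      have e : (fun j => singularCohomology.map ℂ ℂ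
          (AlgPoints.mapContinuous (L := ℂ) ((x • 𝟙 B + Y) : B ⟶ B).hom.hom.hom) 1 (𝔅 (τ j, σ j))) =
          fun j => ((x : ℂ) + ρ (σ j)) • 𝔅 (τ j, σ j) := by
        funext j
        exact hGY x (τ j, σ j)
      rw [e, MultilinearMap.map_smul_univ, Multiset.map_map, Finset.prod_eq_multiset_prod]
      rfl
    have hcardM : ∀ σ : Fin d → Fin n, (Finset.univ.val.map fun j => ρ (σ j)).card = d := fun σ => by
      rw [Multiset.card_map, Finset.card_val, Finset.card_univ, Fintype.card_fin]
    -- constant `σ`: in the joint kernel; non-constant `σ`: zero `D`-component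
    have hconst : ∀ s : Fin n, maskD (t fun _ => s) = t fun _ => s := by
      intro s
      apply claimB
      intro k hk
      have hrep : (Finset.univ.val.map fun _ : Fin d => ρ s) = Multiset.replicate d (ρ s) := by
        rw [Multiset.map_const', Finset.card_val, Finset.card_univ, Fintype.card_fin]
      have := ((hcrit _ (hcardM fun _ => s)).2 ⟨ρ s, hrep⟩) k hk
      rw [hR k hk _ _ (hcardM _) (heig _), sub_eq_zero.mpr this, zero_smul]
    have hnonconst : ∀ σ : Fin d → Fin n, (¬ ∃ s, σ = fun _ => s) → maskD (t σ) = 0 := by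
      intro σ hσ
      have hne : ¬ ∃ r, (Finset.univ.val.map fun j => ρ (σ j)) = Multiset.replicate d r := by
        rintro ⟨r, hr⟩
        apply hσ
        refine ⟨σ ⟨0, hd⟩, funext fun j => hρ ?_⟩
        have hj : ρ (σ j) ∈ Multiset.replicate d r := by
          rw [← hr]; exact Multiset.mem_map_of_mem _ (Finset.mem_univ_val j)
        have h0 : ρ (σ ⟨0, hd⟩) ∈ Multiset.replicate d r := by
          rw [← hr]; exact Multiset.mem_map_of_mem _ (Finset.mem_univ_val _)
        rw [Multiset.eq_of_mem_replicate hj, Multiset.eq_of_mem_replicate h0]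
      rw [← hcrit _ (hcardM σ)] at hne
      push Not at hne
      obtain ⟨k, hk, hne⟩ := hne
      refine claimA (t σ) k _ hk (sub_ne_zero.mpr hne) ?_
      rw [hR k hk _ _ (hcardM σ) (heig σ)]
    -- assemble
    rw [hpull, map_sum]
    have hsplit : ∑ σ : Fin d → Fin n, maskD (t σ) = ∑ s : Fin n, t fun _ => s := by
      rw [← Finset.sum_filter_add_sum_filter_not Finset.univ (fun σ : Fin d → Fin n => ∃ s, σ = fun _ => s)]
      rw [Finset.sum_eq_zero (s := Finset.univ.filter fun σ => ¬ ∃ s, σ = fun _ => s)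
        (fun σ hσ => hnonconst σ (Finset.mem_filter.mp hσ).2), add_zero]
      have himg : (Finset.univ.filter fun σ : Fin d → Fin n => ∃ s, σ = fun _ => s) =
          Finset.univ.image fun s : Fin n => fun _ : Fin d => s := by
        ext σ
        simp only [Finset.mem_filter, Finset.mem_univ, true_and, Finset.mem_image]
        constructor
        · rintro ⟨s, rfl⟩; exact ⟨s, rfl⟩
        · rintro ⟨s, rfl⟩; exact ⟨s, rfl⟩
      rw [himg, Finset.sum_image]
      · exact Finset.sum_congr rfl fun s _ => hconst s
      · intro s _ s' _ h
        exact congrFun h ⟨0, hd⟩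
    rw [hsplit, map_sum]
    have hback : ∀ s : Fin n, complexBetti.map ι₀.hom.hom.hom d (t fun _ => s) = cupA (v ∘ τ) := by
      intro s
      change singularCohomology.map ℂ ℂ (AlgPoints.mapContinuous (L := ℂ) ι₀.hom.hom.hom) d (cupPowOne ℂ _ d _) = _
      rw [map_cupPowOne]
      congr 1
      funext j
      exact hι (τ j) s
    simp_rw [hback]
    rw [Finset.sum_const, Finset.card_univ, Fintype.card_fin, Nat.cast_smul_eq_nsmul]
  -- extend from the monomials `cupA (v ∘ τ)` to all of `Hᵈ(A)` by multilinearity and the span property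
  have hexpand : ∀ w : Fin d → complexBetti A.X 1,
      cupA w = ∑ τ : Fin d → Fin N, (∏ j, v.repr (w j) (τ j)) • cupA (v ∘ τ) := by
    intro w
    have e : w = fun j => ∑ l ∈ (Finset.univ : Finset (Fin N)), v.repr (w j) l • v l := by
      funext j
      exact (v.sum_repr (w j)).symm
    conv_lhs => rw [e]
    change cupPowOne ℂ _ d _ = _
    rw [MultilinearMap.map_sum_finset, Fintype.piFinset_univ]
    refine Finset.sum_congr rfl fun τ _ => ?_
    rw [MultilinearMap.map_smul_univ]
    rfl
  let L₁ : complexBetti A.X d →ₗ[ℂ] complexBetti A.X d :=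
    (complexBetti.map ι₀.hom.hom.hom d).hom ∘ₗ maskD ∘ₗ (complexBetti.map πp.hom.hom.hom d).hom
  let L₂ : complexBetti A.X d →ₗ[ℂ] complexBetti A.X d := (n : ℂ) • LinearMap.id
  have hL : L₁ = L₂ := by
    refine LinearMap.ext_on (hΛA.span_range_cupPowOne d) ?_
    rintro _ ⟨w, rfl⟩
    change complexBetti.map ι₀.hom.hom.hom d (maskD (complexBetti.map πp.hom.hom.hom d (cupA w))) = (n : ℂ) • cupA w
    rw [hexpand, map_sum, map_sum, map_sum, Finset.smul_sum]
    refine Finset.sum_congr rfl fun τ _ => ?_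
    rw [map_smul, map_smul, map_smul, main τ, smul_comm]
  intro x
  exact LinearMap.congr_fun hL x

end Summit.HodgeConjecture.HodgeConjecture.Theorems.HodgeAbelianVarieties.CMPivotAndre

end
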